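import Summits.NavierStokesRegularity.NavierStokesRegularity.Theorems.LerayQuarterDissipationFiniteDissipationLiouvilleSliceHolder
import Summits.NavierStokesRegularity.NavierStokesRegularity.Theorems.LerayQuarterDissipationFiniteDissipationLiouvilleApexUniform
import HarnessLib

/-!
# Crux `FiniteDissipationLiouville` (stmt-NavierStokesRegularity-22144): tools for the
# finite-singular-set leaf — the gauged slice estimate and the CKN quantity on disjoint balls
# (file 3/4)

Theorems file of route `LerayQuarterDissipation` (lead prover g4; `--supports` the crux). The two
quantitative steps of the finite-singular-set theorem (file 4/4,
`…FiniteSingularSet.lean`), for a member `u` of the stratum `𝒟_{C,K}` (Type-I ancient mild field in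
the KNSS gauge with Leray's quarter-rate dissipation law `∫ ‖∇u(s)‖² ≤ K/√(−s)`):

* `exists_gauge_sliceBound` — **Step 1, the slice estimate with constants fixed before the
  member**: absolute `g₁ > 0`, `g₂ ≥ 0`, `C_L > 0` such that every member is classical on
  `(−∞, 0) × ℝ³` for one smooth gauged Calderón–Zygmund pressure `p` (lead g3's gauge) with
  `∫_E (|u(t)|³ + |p(t)|^{3/2}) ≤ (C_L √(K⁺))³ (−t)^{−3/4} (g₁ |E|^{1/2} + g₂ |E|)` for
  `t ∈ (−1, 0)` and every set `E` of finite measure (slices in `L⁶` at the Type-I rate, lead g0;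
  `‖Q(t)‖_{L³} ≲ ‖u(t)‖²_{L⁶}` for the Riesz pressure and the bounded gauge constant; Hölder on `E`,
  file 2/4 `…SliceHolder.lean`).
* `sum_lintegral_cylinders_le` — **Step 2, the CKN quantity on `N` disjoint balls**:
  `Σ_{x∈S} ∫_{−2r²}^{0}∫_{B(x,r)} (|u|³ + |p|^{3/2}) ≤ Λ (g₁ (N r³ |B₁|)^{1/2} + g₂ N r³ |B₁|) 4(2r²)^{1/4}`
  (Tonelli, Step 1 on the union, `∫_{−2r²}^0 (−t)^{−3/4} dt = 4 (2r²)^{1/4}`).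

Plus the abstract slice estimate `setLIntegral_cube_add_pressure_le`, the separation of a finite
point set and the measure of a finite union of balls. Navier–Stokes regularity is NOT proved by
anything here; no summit is.

References: D. Chae, J. Wolf, arXiv:1610.09464, §2 Step 2 (2.4a)–(2.4c); L. Caffarelli, R. Kohn,
L. Nirenberg, Comm. Pure Appl. Math. 35 (1982).
-/

noncomputable section

-- the summit and its single sub-problem share the name (CONVENTIONS §1), as in every Theorems file
set_option linter.dupNamespace false

namespace Summit.NavierStokesRegularity.NavierStokesRegularity.Theorems.FiniteDissipationLiouville.Birth.Apex

open MeasureTheory Set Filter Topology Metric Function TopologicalSpace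
open Literature.Analysis Literature.Analysis.FluidPDE
open scoped ENNReal NNReal

/-! ### Real-power bookkeeping -/

/-- `(a ℓ²)^{3/2} = a^{3/2} ℓ³` for `a, ℓ ≥ 0`. -/
theorem mul_sq_rpow_threeHalves {a ℓ : ℝ} (ha : 0 ≤ a) (hℓ : 0 ≤ ℓ) :
    (a * ℓ ^ 2) ^ (3 / 2 : ℝ) = a ^ (3 / 2 : ℝ) * ℓ ^ 3 := by
  rw [Real.mul_rpow ha (sq_nonneg ℓ)]
  congr 1
  rw [show ℓ ^ 2 = ℓ ^ (2 : ℝ) from (Real.rpow_natCast ℓ 2).symm, ← Real.rpow_mul hℓ,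
    show (2 : ℝ) * (3 / 2) = (3 : ℕ) by norm_num, Real.rpow_natCast]

/-- `(A (−t)^{−1/4})³ = A³ (−t)^{−3/4}` for `t < 0`. -/
theorem cube_mul_rpow_neg_quarter {A t : ℝ} (ht : t < 0) :
    (A * (-t) ^ (-(1 / 4 : ℝ))) ^ 3 = A ^ 3 * (-t) ^ (-(3 / 4 : ℝ)) := by
  rw [mul_pow]
  congr 1
  rw [← Real.rpow_natCast, ← Real.rpow_mul (by linarith)]
  norm_num

/-! ### The slice estimate (abstract form) -/

/-- **The slice estimate, abstract form.** If `‖v‖_{L⁶} ≤ ℓ`, `pr = Q + c` a.e. with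
`‖Q‖_{L³} ≤ C_q ℓ²` and `|c| ≤ κ C_q ℓ²`, then on every set `E` of finite measure
`∫_E (|v|³ + |pr|^{3/2}) ≤ ℓ³ ((1 + √2 C_q^{3/2}) |E|^{1/2} + √2 (κ C_q)^{3/2} |E|)`. -/
theorem setLIntegral_cube_add_pressure_le
    {v : EuclideanSpace ℝ (Fin 3) → EuclideanSpace ℝ (Fin 3)} {pr Q : EuclideanSpace ℝ (Fin 3) → ℝ}
    {c ℓ Cq κ : ℝ} (hv : AEStronglyMeasurable v volume) (hQ : AEStronglyMeasurable Q volume)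
    (hae : ∀ᵐ x ∂(volume : Measure (EuclideanSpace ℝ (Fin 3))), pr x = Q x + c)
    (hℓ : 0 ≤ ℓ) (hCq : 0 ≤ Cq) (hκ : 0 ≤ κ)
    (h6 : eLpNorm v (ENNReal.ofReal 6) volume ≤ ENNReal.ofReal ℓ)
    (h3 : eLpNorm Q 3 volume ≤ ENNReal.ofReal (Cq * ℓ ^ 2)) (hc : |c| ≤ κ * Cq * ℓ ^ 2)
    {E : Set (EuclideanSpace ℝ (Fin 3))} (hE : volume E ≠ ⊤) :
    ∫⁻ x in E, (‖v x‖ₑ ^ (3 : ℕ) + ‖pr x‖ₑ ^ (3 / 2 : ℝ)) ≤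
      ENNReal.ofReal (ℓ ^ 3 * ((1 + (2 : ℝ) ^ (1 / 2 : ℝ) * Cq ^ (3 / 2 : ℝ)) * (volume.real E) ^ (1 / 2 : ℝ) +
        (2 : ℝ) ^ (1 / 2 : ℝ) * (κ * Cq) ^ (3 / 2 : ℝ) * volume.real E)) := by
  set m : ℝ := volume.real E with hm
  have hm0 : 0 ≤ m := measureReal_nonneg
  have hEm : volume E = ENNReal.ofReal m := by rw [hm, measureReal_def, ENNReal.ofReal_toReal hE]
  have hv3 : AEMeasurable (fun x => ‖v x‖ₑ ^ (3 : ℕ)) (volume.restrict E) :=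
    (hv.enorm.pow_const 3).restrict
  -- the three pieces, each `≤ ofReal(real)`
  have hP0 : 0 ≤ Cq * ℓ ^ 2 := by positivity
  have h1 : ∫⁻ x in E, ‖v x‖ₑ ^ (3 : ℕ) ≤ ENNReal.ofReal (ℓ ^ 3 * m ^ (1 / 2 : ℝ)) := by
    refine (setLIntegral_enorm_cube_le hv E).trans ?_
    rw [hEm, ENNReal.ofReal_rpow_of_nonneg hm0 (by norm_num), ENNReal.ofReal_mul (by positivity)]
    gcongr
    calc eLpNorm v (ENNReal.ofReal 6) volume ^ (3 : ℝ) ≤ ENNReal.ofReal ℓ ^ (3 : ℝ) := by gcongr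
      _ = ENNReal.ofReal (ℓ ^ 3) := by
          rw [ENNReal.ofReal_rpow_of_nonneg hℓ (by norm_num)]
          norm_num
  have h2 : eLpNorm Q 3 volume ^ (3 / 2 : ℝ) * (volume E) ^ (1 / 2 : ℝ) ≤
      ENNReal.ofReal ((Cq * ℓ ^ 2) ^ (3 / 2 : ℝ) * m ^ (1 / 2 : ℝ)) := by
    rw [hEm, ENNReal.ofReal_rpow_of_nonneg hm0 (by norm_num), ENNReal.ofReal_mul (by positivity),
      ← ENNReal.ofReal_rpow_of_nonneg hP0 (by norm_num)]
    gcongr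
  have h3' : ‖c‖ₑ ^ (3 / 2 : ℝ) * volume E ≤
      ENNReal.ofReal ((κ * Cq * ℓ ^ 2) ^ (3 / 2 : ℝ) * m) := by
    rw [hEm, ENNReal.ofReal_mul (by positivity), Real.enorm_eq_ofReal_abs,
      ENNReal.ofReal_rpow_of_nonneg (abs_nonneg c) (by norm_num)]
    gcongr
  have hp := setLIntegral_enorm_rpow_threeHalves_add_const_le (pr := pr) hQ hae E
  have e2 : (2 : ℝ≥0∞) ^ (1 / 2 : ℝ) = ENNReal.ofReal ((2 : ℝ) ^ (1 / 2 : ℝ)) := by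
    rw [← ENNReal.ofReal_rpow_of_nonneg (by norm_num : (0 : ℝ) ≤ 2) (by norm_num)]
    norm_num
  -- assemble
  calc ∫⁻ x in E, (‖v x‖ₑ ^ (3 : ℕ) + ‖pr x‖ₑ ^ (3 / 2 : ℝ))
      = (∫⁻ x in E, ‖v x‖ₑ ^ (3 : ℕ)) + ∫⁻ x in E, ‖pr x‖ₑ ^ (3 / 2 : ℝ) :=
        lintegral_add_left' hv3 _
    _ ≤ ENNReal.ofReal (ℓ ^ 3 * m ^ (1 / 2 : ℝ)) +
        ENNReal.ofReal ((2 : ℝ) ^ (1 / 2 : ℝ)) *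
          (ENNReal.ofReal ((Cq * ℓ ^ 2) ^ (3 / 2 : ℝ) * m ^ (1 / 2 : ℝ)) +
            ENNReal.ofReal ((κ * Cq * ℓ ^ 2) ^ (3 / 2 : ℝ) * m)) := by
        rw [← e2]
        gcongr
        exact hp.trans (by gcongr)
    _ = ENNReal.ofReal (ℓ ^ 3 * m ^ (1 / 2 : ℝ) + (2 : ℝ) ^ (1 / 2 : ℝ) *
          ((Cq * ℓ ^ 2) ^ (3 / 2 : ℝ) * m ^ (1 / 2 : ℝ) + (κ * Cq * ℓ ^ 2) ^ (3 / 2 : ℝ) * m)) := by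
        rw [← ENNReal.ofReal_add (by positivity) (by positivity),
          ← ENNReal.ofReal_mul (by positivity), ← ENNReal.ofReal_add (by positivity) (by positivity)]
    _ = ENNReal.ofReal (ℓ ^ 3 * ((1 + (2 : ℝ) ^ (1 / 2 : ℝ) * Cq ^ (3 / 2 : ℝ)) * m ^ (1 / 2 : ℝ) +
          (2 : ℝ) ^ (1 / 2 : ℝ) * (κ * Cq) ^ (3 / 2 : ℝ) * m)) := by
        congr 1
        rw [mul_sq_rpow_threeHalves hCq hℓ, show κ * Cq * ℓ ^ 2 = (κ * Cq) * ℓ ^ 2 by ring,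
          mul_sq_rpow_threeHalves (mul_nonneg hκ hCq) hℓ]
        ring

/-! ### Finite point sets: separation and the measure of a union of balls -/

/-- **A finite set of points is separated**: some `δ > 0` bounds the pairwise distances from
below. -/
theorem exists_pos_le_dist (S : Finset (EuclideanSpace ℝ (Fin 3))) :
    ∃ δ : ℝ, 0 < δ ∧ ∀ x ∈ S, ∀ y ∈ S, x ≠ y → δ ≤ dist x y := by
  classical
  set T := (S ×ˢ S).filter (fun q => q.1 ≠ q.2) with hT
  by_cases hT0 : T.Nonempty
  · obtain ⟨q, hq, hmin⟩ := T.exists_min_image (fun q => dist q.1 q.2) hT0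
    have hq' : q.1 ≠ q.2 := (Finset.mem_filter.1 hq).2
    refine ⟨dist q.1 q.2, dist_pos.2 hq', fun x hx y hy hxy => ?_⟩
    exact hmin (x, y) (Finset.mem_filter.2 ⟨Finset.mem_product.2 ⟨hx, hy⟩, hxy⟩)
  · refine ⟨1, one_pos, fun x hx y hy hxy => ?_⟩
    exact absurd ⟨(x, y), Finset.mem_filter.2 ⟨Finset.mem_product.2 ⟨hx, hy⟩, hxy⟩⟩ hT0

/-- **The measure of a finite union of balls of radius `r`** is at most `N r³ |B₁|`. -/
theorem volume_biUnion_ball_le (S : Finset (EuclideanSpace ℝ (Fin 3))) {r : ℝ} (hr : 0 ≤ r) :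
    volume (⋃ x ∈ S, ball x r) ≤
      ENNReal.ofReal (S.card * r ^ 3 * volume.real (ball (0 : EuclideanSpace ℝ (Fin 3)) 1)) := by
  refine (measure_biUnion_finset_le S _).trans (le_of_eq ?_)
  have hb : ∀ x ∈ S, volume (ball x r) =
      ENNReal.ofReal (r ^ 3) * volume (ball (0 : EuclideanSpace ℝ (Fin 3)) 1) := fun x _ => by
    rw [Measure.addHaar_ball volume x hr, finrank_euclideanSpace_fin]
  rw [Finset.sum_congr rfl hb, Finset.sum_const, nsmul_eq_mul]
  have hfin : volume (ball (0 : EuclideanSpace ℝ (Fin 3)) 1) ≠ ⊤ := measure_ball_lt_top.ne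
  rw [← ENNReal.ofReal_toReal hfin, ← ENNReal.ofReal_natCast, ← ENNReal.ofReal_mul (by positivity),
    ← ENNReal.ofReal_mul (by positivity), measureReal_def]
  congr 1
  ring

/-! ### Step 1: the gauged pressure of a member and its slice bound -/

/-- **The slice bound of a member of the stratum, constants fixed before the member.** There are
absolute `g₁ > 0`, `g₂ ≥ 0`, `C_L > 0` such that every member `u` of every stratum `𝒟_{C,K}` is a
classical solution on `(−∞, 0) × ℝ³` for one smooth (gauged Calderón–Zygmund) pressure `p` with,
for every `t ∈ (−1, 0)` and every set `E` of finite measure,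
`∫_E (|u(t)|³ + |p(t)|^{3/2}) ≤ (C_L √(K⁺))³ (−t)^{−3/4} (g₁ |E|^{1/2} + g₂ |E|)`. -/
theorem exists_gauge_sliceBound :
    ∃ g₁ g₂ CL : ℝ, 0 < g₁ ∧ 0 ≤ g₂ ∧ 0 < CL ∧
      ∀ (C K : ℝ) (u : ℝ → EuclideanSpace ℝ (Fin 3) → EuclideanSpace ℝ (Fin 3)),
      IsTypeIAncientMild C u →
      (∀ s : ℝ, s < 0 → ∫⁻ x, ‖fderiv ℝ (u s) x‖ₑ ^ 2 ≤ ENNReal.ofReal (K / Real.sqrt (-s))) →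
      ∃ p : ℝ → EuclideanSpace ℝ (Fin 3) → ℝ, IsClassicalNSSolutionOn (Iio 0) 1 0 u p ∧
        ∀ t ∈ Ioo (-1 : ℝ) 0, ∀ E : Set (EuclideanSpace ℝ (Fin 3)), volume E ≠ ⊤ →
          ∫⁻ x in E, (‖u t x‖ₑ ^ (3 : ℕ) + ‖p t x‖ₑ ^ (3 / 2 : ℝ)) ≤
            ENNReal.ofReal ((CL * Real.sqrt (max K 0)) ^ 3 * (-t) ^ (-(3 / 4 : ℝ)) *
              (g₁ * (volume.real E) ^ (1 / 2 : ℝ) + g₂ * volume.real E)) := by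
  -- absolute constants
  obtain ⟨CL, hCL, hsix⟩ := exists_eLpNorm_six_rate_unif
  obtain ⟨Cq, hCq⟩ := exists_rieszPressure (show (1 : ℝ) < 6 / 2 by norm_num)
  let θ₁ : ContDiffBump (0 : EuclideanSpace ℝ (Fin 3)) := ⟨1 / 2, 1, by norm_num, by norm_num⟩
  obtain ⟨B₁, hB₁⟩ : ∃ B₁ : ℝ, B₁ = 1 / (volume : Measure (EuclideanSpace ℝ (Fin 3))).real
      (closedBall (0 : EuclideanSpace ℝ (Fin 3)) θ₁.rIn) := ⟨_, rfl⟩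
  have hB₁le : ∀ y, θ₁.normed volume y ≤ B₁ := fun y => by
    rw [hB₁]; exact θ₁.normed_le_div_measure_closedBall_rIn volume y
  have hB₁0 : 0 ≤ B₁ := (θ₁.nonneg_normed 0).trans (hB₁le 0)
  obtain ⟨V₁, hV₁⟩ : ∃ V₁ : ℝ, V₁ = (volume : Measure (EuclideanSpace ℝ (Fin 3))).real
      (closedBall (0 : EuclideanSpace ℝ (Fin 3)) θ₁.rOut) := ⟨_, rfl⟩
  have hV₁0 : 0 ≤ V₁ := by rw [hV₁]; exact measureReal_nonneg
  obtain ⟨κ₁, hκ₁⟩ : ∃ κ₁ : ℝ, κ₁ = B₁ * V₁ ^ (1 - 2 / 6 : ℝ) := ⟨_, rfl⟩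
  have hκ₁0 : 0 ≤ κ₁ := by rw [hκ₁]; positivity
  refine ⟨1 + (2 : ℝ) ^ (1 / 2 : ℝ) * (Cq : ℝ) ^ (3 / 2 : ℝ),
    (2 : ℝ) ^ (1 / 2 : ℝ) * (κ₁ * Cq) ^ (3 / 2 : ℝ), CL, by positivity, by positivity, hCL,
    fun C K u hu hlaw => ?_⟩
  -- the member
  obtain ⟨A, hA⟩ : ∃ A : ℝ, A = CL * Real.sqrt (max K 0) := ⟨_, rfl⟩
  have hA0 : 0 ≤ A := by rw [hA]; positivity
  obtain ⟨p₀, hsol₀⟩ := exists_isClassicalNSSolutionOn_Iio hu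
  obtain ⟨m₀, hm₀, hm₀val⟩ := ChaeWolfEnergy.exists_smooth_normaliser hsol₀ isOpen_Iio 0 θ₁
  obtain ⟨p, hp⟩ : ∃ p : ℝ → EuclideanSpace ℝ (Fin 3) → ℝ, p = fun t x => p₀ t x - m₀ t :=
    ⟨_, rfl⟩
  have hsol : IsClassicalNSSolutionOn (Iio 0) 1 0 u p := by
    rw [hp]; exact isClassicalNSSolutionOn_sub_normaliser hsol₀ hm₀
  have hLq : ∀ t ∈ Ioo (-1 : ℝ) 0, MemLp (u t) (ENNReal.ofReal 6) volume :=
    fun t ht => (hsix C K u hu hlaw t ht.2).1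
  have hrate : ∀ t ∈ Ioo (-1 : ℝ) 0,
      eLpNorm (u t) (ENNReal.ofReal 6) volume ≤ ENNReal.ofReal (A * (-t) ^ (-(1 / 4 : ℝ))) := by
    intro t ht
    have h := (hsix C K u hu hlaw t ht.2).2
    rw [show (-((6 - 3) / (2 * 6) : ℝ)) = -(1 / 4 : ℝ) by norm_num] at h
    rw [hA]; exact h
  have hdec := ChaeWolfEnergy.exists_rieszPressure_slice_of_rate_of_const (q := 6) (by norm_num) hCq
    hsol₀ (κ := 1 / 4) (K₀ := A) (T := 1) (by norm_num) hA0 hLq hrate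
  have e3 : ENNReal.ofReal (6 / 2 : ℝ) = 3 := by norm_num
  refine ⟨p, hsol, fun t ht E hE => ?_⟩
  rw [← hA]
  obtain ⟨Q, hQmem, hQle, -, Ct, hCt⟩ := hdec t ht
  have hnt : 0 < -t := by linarith [ht.2]
  obtain ⟨ℓ, hℓ⟩ : ∃ ℓ : ℝ, ℓ = A * (-t) ^ (-(1 / 4 : ℝ)) := ⟨_, rfl⟩
  have hℓ0 : 0 ≤ ℓ := by rw [hℓ]; exact mul_nonneg hA0 (Real.rpow_nonneg hnt.le _)
  have h6 : eLpNorm (u t) (ENNReal.ofReal 6) volume ≤ ENNReal.ofReal ℓ := by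
    rw [hℓ]; exact hrate t ht
  -- `‖Q‖₃ ≤ Cq ℓ²`
  have hΛ2 : (Cq : ℝ≥0∞) * eLpNorm (u t) (ENNReal.ofReal 6) volume ^ 2 ≤
      ENNReal.ofReal (Cq * ℓ ^ 2) := by
    rw [ENNReal.ofReal_mul Cq.coe_nonneg, ENNReal.ofReal_coe_nnreal, ENNReal.ofReal_pow hℓ0]
    gcongr
  have h3 : eLpNorm Q 3 volume ≤ ENNReal.ofReal (Cq * ℓ ^ 2) := by
    rw [← e3]; exact hQle.trans hΛ2
  -- the gauge constant: `|m₀ t − Ct| ≤ κ₁ Cq ℓ²`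
  have hP0 : 0 ≤ (Cq : ℝ) * ℓ ^ 2 := by positivity
  have hQP : eLpNorm Q (ENNReal.ofReal (6 / 2)) volume ≤ (((Cq : ℝ) * ℓ ^ 2).toNNReal : ℝ≥0∞) :=
    hQle.trans hΛ2
  have hgauge := abs_normaliser_sub_const_le (q := 6) (by norm_num) 0 θ₁ hB₁le hQmem hQP hCt
  rw [← hm₀val t ht.2, Real.coe_toNNReal _ hP0, ← hV₁] at hgauge
  have hc : |Ct - m₀ t| ≤ κ₁ * Cq * ℓ ^ 2 := by
    rw [abs_sub_comm]
    refine hgauge.trans (le_of_eq ?_)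
    rw [hκ₁]
    ring
  have hae : ∀ᵐ x ∂(volume : Measure (EuclideanSpace ℝ (Fin 3))), p t x = Q x + (Ct - m₀ t) := by
    filter_upwards [hCt] with x hx
    rw [hp]
    show p₀ t x - m₀ t = Q x + (Ct - m₀ t)
    rw [hx]
    ring
  have hmain := setLIntegral_cube_add_pressure_le (hu.aestronglyMeasurable_slice ht.2) hQmem.1 hae
    hℓ0 Cq.coe_nonneg hκ₁0 h6 h3 hc hE
  rw [hℓ, cube_mul_rpow_neg_quarter ht.2] at hmain
  exact hmain

/-! ### Step 2: the CKN quantity on a union of disjoint small balls -/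

/-- **The CKN quantity on `N` disjoint balls at the final time.** If the slices obey
`∫_E (|u(t)|³ + |p(t)|^{3/2}) ≤ Λ (−t)^{−3/4} (g₁ |E|^{1/2} + g₂ |E|)` for `t ∈ (−1, 0)` and all `E`
of finite measure, then for `0 < r ≤ 1/2` and a finite set `S` of centres of pairwise disjoint
balls of radius `r`,
`Σ_{x ∈ S} ∫_{−2r²}^{0} ∫_{B(x,r)} (|u|³ + |p|^{3/2}) ≤ Λ (g₁ (N r³ |B₁|)^{1/2} + g₂ N r³ |B₁|) · 4 (2r²)^{1/4}`
(`N = #S`, `|B₁|` the volume of the unit ball; Tonelli, Hölder on the union, the time integral). -/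
theorem sum_lintegral_cylinders_le {u : ℝ → EuclideanSpace ℝ (Fin 3) → EuclideanSpace ℝ (Fin 3)}
    {p : ℝ → EuclideanSpace ℝ (Fin 3) → ℝ} {Λ g₁ g₂ : ℝ} (hΛ : 0 ≤ Λ) (hg₁ : 0 ≤ g₁) (hg₂ : 0 ≤ g₂)
    (hslice : ∀ t ∈ Ioo (-1 : ℝ) 0, ∀ E : Set (EuclideanSpace ℝ (Fin 3)), volume E ≠ ⊤ →
      ∫⁻ x in E, (‖u t x‖ₑ ^ (3 : ℕ) + ‖p t x‖ₑ ^ (3 / 2 : ℝ)) ≤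
        ENNReal.ofReal (Λ * (-t) ^ (-(3 / 4 : ℝ)) *
          (g₁ * (volume.real E) ^ (1 / 2 : ℝ) + g₂ * volume.real E)))
    {r : ℝ} (hr0 : 0 < r) (hr1 : r ≤ 1 / 2) (S : Finset (EuclideanSpace ℝ (Fin 3)))
    (hdisj : ∀ x ∈ S, ∀ y ∈ S, x ≠ y → Disjoint (ball x r) (ball y r)) :
    ∑ x ∈ S, ∫⁻ z in Ioo (-(2 * r ^ 2)) 0 ×ˢ ball x r,
        (‖u z.1 z.2‖ₑ ^ (3 : ℕ) + ‖p z.1 z.2‖ₑ ^ (3 / 2 : ℝ)) ≤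
      ENNReal.ofReal (Λ * (g₁ * (S.card * r ^ 3 *
          volume.real (ball (0 : EuclideanSpace ℝ (Fin 3)) 1)) ^ (1 / 2 : ℝ) +
        g₂ * (S.card * r ^ 3 * volume.real (ball (0 : EuclideanSpace ℝ (Fin 3)) 1))) *
        (4 * (2 * r ^ 2) ^ (1 / 4 : ℝ))) := by
  obtain ⟨v, hv⟩ : ∃ v : ℝ, v = (volume : Measure (EuclideanSpace ℝ (Fin 3))).real
      (ball (0 : EuclideanSpace ℝ (Fin 3)) 1) := ⟨_, rfl⟩
  rw [← hv]
  have hv0 : 0 ≤ v := by rw [hv]; exact measureReal_nonneg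
  have hI1 : Ioo (-(2 * r ^ 2)) (0 : ℝ) ⊆ Ioo (-1 : ℝ) 0 := Ioo_subset_Ioo (by nlinarith) le_rfl
  obtain ⟨E, hEdef⟩ : ∃ E : Set (EuclideanSpace ℝ (Fin 3)), E = ⋃ x ∈ S, ball x r := ⟨_, rfl⟩
  have hEvol : volume E ≤ ENNReal.ofReal (S.card * r ^ 3 * v) := by
    rw [hEdef, hv]; exact volume_biUnion_ball_le S hr0.le
  have hEfin : volume E ≠ ⊤ := ne_top_of_le_ne_top ENNReal.ofReal_ne_top hEvol
  obtain ⟨m, hm⟩ : ∃ m : ℝ, m = volume.real E := ⟨_, rfl⟩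
  have hm0 : 0 ≤ m := by rw [hm]; exact measureReal_nonneg
  have hmle : m ≤ S.card * r ^ 3 * v := by
    rw [hm, measureReal_def]
    exact ENNReal.toReal_le_of_le_ofReal (by positivity) hEvol
  obtain ⟨G, hG⟩ : ∃ G : ℝ, G = g₁ * m ^ (1 / 2 : ℝ) + g₂ * m := ⟨_, rfl⟩
  have hG0 : 0 ≤ G := by rw [hG]; positivity
  have hGle : G ≤ g₁ * (S.card * r ^ 3 * v) ^ (1 / 2 : ℝ) + g₂ * (S.card * r ^ 3 * v) := by
    rw [hG]
    exact add_le_add (mul_le_mul_of_nonneg_left (Real.rpow_le_rpow hm0 hmle (by norm_num)) hg₁)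
      (mul_le_mul_of_nonneg_left hmle hg₂)
  -- the union of the cylinders
  have hpd : Set.PairwiseDisjoint (↑S : Set (EuclideanSpace ℝ (Fin 3)))
      (fun x => Ioo (-(2 * r ^ 2)) (0 : ℝ) ×ˢ ball x r) := by
    intro x hx y hy hxy
    exact (hdisj x hx y hy hxy).set_prod_right _ _
  have hms : ∀ x ∈ S, MeasurableSet (Ioo (-(2 * r ^ 2)) (0 : ℝ) ×ˢ ball x r) :=
    fun x _ => measurableSet_Ioo.prod measurableSet_ball
  rw [← lintegral_biUnion_finset hpd hms]
  have hsub : (⋃ x ∈ S, Ioo (-(2 * r ^ 2)) (0 : ℝ) ×ˢ ball x r) ⊆ Ioo (-(2 * r ^ 2)) 0 ×ˢ E := by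
    rw [hEdef]
    exact iUnion₂_subset fun x hx =>
      prod_mono_right (subset_biUnion_of_mem (u := fun x => ball x r) hx)
  refine (lintegral_mono_set hsub).trans ?_
  refine (setLIntegral_prod_le_lintegral_lintegral _ E _).trans ?_
  have hbound : ∀ᵐ t ∂(volume.restrict (Ioo (-(2 * r ^ 2)) (0 : ℝ))),
      ∫⁻ x in E, (‖u t x‖ₑ ^ (3 : ℕ) + ‖p t x‖ₑ ^ (3 / 2 : ℝ)) ≤
        ENNReal.ofReal (Λ * G) * ENNReal.ofReal ((-t) ^ (-(3 / 4 : ℝ))) := by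
    refine (ae_restrict_iff' measurableSet_Ioo).2 (ae_of_all _ fun t ht => ?_)
    have h := hslice t (hI1 ht) E hEfin
    rw [← hm, ← hG] at h
    rw [← ENNReal.ofReal_mul (by positivity)]
    refine h.trans (le_of_eq ?_)
    congr 1
    ring
  refine (lintegral_mono_ae hbound).trans ?_
  rw [lintegral_const_mul' _ _ ENNReal.ofReal_ne_top,
    lintegral_Ioo_rpow_neg_threeQuarters (by positivity : (0 : ℝ) < 2 * r ^ 2),
    ← ENNReal.ofReal_mul (by positivity)]
  have h40 : 0 ≤ 4 * (2 * r ^ 2) ^ (1 / 4 : ℝ) := by positivity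
  exact ENNReal.ofReal_le_ofReal (mul_le_mul_of_nonneg_right
    (mul_le_mul_of_nonneg_left hGle hΛ) h40)

end Summit.NavierStokesRegularity.NavierStokesRegularity.Theorems.FiniteDissipationLiouville.Birth.Apex

end
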